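import Summits.Ventures.Crystal3D.Theorems.StickyWulffConstantCoaxialWallLawSeamIncoherentAssembly
import Summits.Ventures.Crystal3D.Theorems.StickyWulffConstantCoaxialWallLawHealCapEleven
import HarnessLib

/-!
# Two rows of the JUNK CAP TABLE in `JunkCapBound` form: closed lower half-dozen ⇒ ≤ 2, eleven slots ⇒ 0 (crux `CoaxialWallLaw`, stmt-Ventures-19481;
# line `WallLedgerF`, skeleton 'CoaxialWallLawCertificates' v8.1, stub `stub_incoherentSeamSmall`, input `JunkCapBound` of `…SeamIncoherentAssembly`)

HONEST FRAMING. Venture `Summits/Ventures/Crystal3D` (cell `crystal3d-full`); two cap-table rows for the crux `CoaxialWallLaw` (stmt-Ventures-19481,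
`route-Ventures-StickyWulffConstant`), lane F T5b.  Nothing about the stubs is claimed; F-C1 not moved.
THE MECHANISM: a ball `x ∉ coreOf X z S` (the capping closure of the site balls) caps NO unit triangle of the core (`…SeamCapClosure.not_capsTriangleIn_of_not_mem`);
every TIP of a core ball `y` whose closed lower half-dozen lies in the core caps the core triangle `{y, y + L s_a, y + L s_b}` of two adjacent hexagon slots
(`healTip_triangle`); so junk touches such a `y` only OFF-tip, hence at most twice (`…HealCap.card_offTip_contacts_le_two`), and a core ball with eleven core slots is
touched by no junk at all (`…HealCapEleven.contact_eq_tip_of_eleven`):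
* `dist_slotSite_slotSite_eq_one`, `healTip_triangle` (the six tips and their hexagon triangles, by cubic coordinates);
* **`junk_contacts_le_two_of_closedHalf`** — `#{x ∈ X ∖ core : dist y x = 1} ≤ 2` when `y + L(slot) ∈ core` for the nine slots of the closed lower half-dozen;
* **`junk_contacts_eq_zero_of_eleven`** — `= 0` when `y + L(slotSite k) ∈ core` for all `k ≠ 2`.
These are the rows «9-slot closed half ⇒ 2» and «11-slot ⇒ 0» of the table `cap` in `JunkCapBound cap`; the remaining rows (10-slot, «hexagon−1 + triple», hexagon-only,
`{100}` square) follow the same pattern with their own cap lemmas.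
-/

noncomputable section

namespace Summit.Ventures.Crystal3D.Theorems

namespace TailResidue

open Summit.Ventures.Crystal3D Finset NearIdentity
open Literature.MathematicalPhysics.StatisticalMechanics (basalMirror)
open scoped InnerProductSpace

/-! ### Tips cap hexagon triangles -/

/-- Adjacent slots (integer dot product `1`) are at distance `1`. -/
theorem dist_slotSite_slotSite_eq_one {a b : Fin 12} (h : slotInt a ⬝ᵥ slotInt b = 1) : dist (slotSite a) (slotSite b) = 1 := by
  have hsq : dist (slotSite a) (slotSite b) ^ 2 = 1 := by
    rw [dist_eq_norm, norm_sub_sq_real, inner_slotSite, h, norm_eq_one_of_mem_fccSlots (slotSite_mem a), norm_eq_one_of_mem_fccSlots (slotSite_mem b)]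
    push_cast; ring
  nlinarith [dist_nonneg (x := slotSite a) (y := slotSite b)]

/-- Distance `1` from cubic coordinates of the difference. -/
theorem dist_eq_one_of_cubicCoords {p q : EuclideanSpace ℝ (Fin 3)}
    (h : (cubicCoords p 0 - cubicCoords q 0) ^ 2 + (cubicCoords p 1 - cubicCoords q 1) ^ 2 + (cubicCoords p 2 - cubicCoords q 2) ^ 2 = 1) :
    dist p q = 1 := by
  have hsq : dist p q ^ 2 = 1 := by
    rw [dist_eq_norm, norm_sq_eq_cubicCoords, cubicCoords_sub]
    simp only [dotProduct, Fin.sum_univ_three, Pi.sub_apply]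
    nlinarith [h]
  nlinarith [dist_nonneg (x := p) (y := q)]

/-- Cubic coordinates of the slots used below (`c = √2/2`). -/
private theorem cc_slot (k : Fin 12) (i : Fin 3) : cubicCoords (slotSite k) i = (slotInt k i : ℝ) / Real.sqrt 2 := by
  rw [cubicCoords_slotSite]; rfl

/-- Cubic coordinates of the basal mirror of a slot. -/
private theorem cc_mirror (k : Fin 12) :
    cubicCoords (basalMirror (slotSite k)) =
      ![((slotInt k 0 : ℝ) + 2 * slotInt k 1 + 2 * slotInt k 2) / 3 / Real.sqrt 2,
        (2 * (slotInt k 0 : ℝ) + slotInt k 1 - 2 * slotInt k 2) / 3 / Real.sqrt 2,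
        (2 * (slotInt k 0 : ℝ) - 2 * slotInt k 1 + slotInt k 2) / 3 / Real.sqrt 2] := by
  rw [cubicCoords_basalMirror]
  ext i; fin_cases i <;> simp [cc_slot] <;> ring

/-- **Every tip caps a hexagon triangle**: for each of the six tips `t` there are two ADJACENT slots `a, b` of the closed lower half-dozen with `t` at distance `1`
from both (and `‖t‖ = 1`). -/
theorem healTip_triangle {t : EuclideanSpace ℝ (Fin 3)} (ht : t ∈ healTips) :
    ∃ a ∈ lowerNine, ∃ b ∈ lowerNine, dist (slotSite a) (slotSite b) = 1 ∧ dist t (slotSite a) = 1 ∧ dist t (slotSite b) = 1 := by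
  have h2 : Real.sqrt 2 ^ 2 = 2 := Real.sq_sqrt (by norm_num)
  have hs : Real.sqrt 2 ≠ 0 := by positivity
  simp only [healTips, mem_insert, mem_singleton] at ht
  rcases ht with rfl | rfl | rfl | rfl | rfl | rfl
  · exact ⟨9, by decide, 7, by decide, dist_slotSite_slotSite_eq_one (by decide), dist_slotSite_slotSite_eq_one (by decide),
      dist_slotSite_slotSite_eq_one (by decide)⟩
  · exact ⟨3, by decide, 10, by decide, dist_slotSite_slotSite_eq_one (by decide), dist_slotSite_slotSite_eq_one (by decide),
      dist_slotSite_slotSite_eq_one (by decide)⟩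
  · exact ⟨0, by decide, 4, by decide, dist_slotSite_slotSite_eq_one (by decide), dist_slotSite_slotSite_eq_one (by decide),
      dist_slotSite_slotSite_eq_one (by decide)⟩
  · refine ⟨4, by decide, 10, by decide, dist_slotSite_slotSite_eq_one (by decide), ?_, ?_⟩ <;>
      apply dist_eq_one_of_cubicCoords <;> simp only [cc_mirror, cc_slot, slotInt, Matrix.cons_val_zero, Matrix.cons_val_one, Matrix.cons_val] <;>
      norm_num <;> field_simp <;> nlinarith [h2]
  · refine ⟨0, by decide, 9, by decide, dist_slotSite_slotSite_eq_one (by decide), ?_, ?_⟩ <;>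
      apply dist_eq_one_of_cubicCoords <;> simp only [cc_mirror, cc_slot, slotInt, Matrix.cons_val_zero, Matrix.cons_val_one, Matrix.cons_val] <;>
      norm_num <;> field_simp <;> nlinarith [h2]
  · refine ⟨3, by decide, 7, by decide, dist_slotSite_slotSite_eq_one (by decide), ?_, ?_⟩ <;>
      apply dist_eq_one_of_cubicCoords <;> simp only [cc_mirror, cc_slot, slotInt, Matrix.cons_val_zero, Matrix.cons_val_one, Matrix.cons_val] <;>
      norm_num <;> field_simp <;> nlinarith [h2]

/-! ### The two rows -/

/-- A ball at a tip of a core ball whose hexagon triangle lies in the core CAPS A CORE TRIANGLE. -/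
theorem capsTriangleIn_of_tip {D : Finset (EuclideanSpace ℝ (Fin 3))} (L : EuclideanSpace ℝ (Fin 3) ≃ₗᵢ[ℝ] EuclideanSpace ℝ (Fin 3))
    {y : EuclideanSpace ℝ (Fin 3)} (hy : y ∈ D) (hocc : ∀ k ∈ lowerNine, y + L (slotSite k) ∈ D) {t : EuclideanSpace ℝ (Fin 3)} (ht : t ∈ healTips) :
    CapsTriangleIn D (y + L t) := by
  obtain ⟨a, ha, b, hb, hab, hta, htb⟩ := healTip_triangle ht
  refine ⟨y, hy, y + L (slotSite a), hocc a ha, y + L (slotSite b), hocc b hb, dist_slotSite_eq_one L y (slotSite_mem a),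
    dist_slotSite_eq_one L y (slotSite_mem b), ?_, ?_, ?_, ?_⟩
  · rw [dist_eq_norm, add_sub_add_left_eq_sub, ← map_sub, LinearIsometryEquiv.norm_map, ← dist_eq_norm, hab]
  · rw [dist_comm]
    have hn : ‖t‖ = 1 := by
      have hsub := healTips_subset_module
      simp only [healTips, mem_insert, mem_singleton] at ht
      rcases ht with rfl | rfl | rfl | rfl | rfl | rfl <;>
        first
        | exact norm_eq_one_of_mem_fccSlots (slotSite_mem _)
        | (rw [LinearIsometryEquiv.norm_map]; exact norm_eq_one_of_mem_fccSlots (slotSite_mem _))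
    rw [dist_eq_norm, show y - (y + L t) = -(L t) by abel, norm_neg, LinearIsometryEquiv.norm_map, hn]
  · rw [dist_eq_norm, add_sub_add_left_eq_sub, ← map_sub, LinearIsometryEquiv.norm_map, ← dist_eq_norm, hta]
  · rw [dist_eq_norm, add_sub_add_left_eq_sub, ← map_sub, LinearIsometryEquiv.norm_map, ← dist_eq_norm, htb]

open scoped Classical in
/-- **ROW «closed lower half-dozen ⇒ ≤ 2»**: a core ball `y` within `2` of the payer whose nine positions over the closed lower half-dozen of a frame `L` are CORE
balls is touched by at most two balls outside the core. -/
theorem junk_contacts_le_two_of_closedHalf {X : Finset (EuclideanSpace ℝ (Fin 3))} (hX : ∀ p ∈ X, ∀ q ∈ X, p ≠ q → 1 ≤ dist p q)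
    {z : EuclideanSpace ℝ (Fin 3)} (S : EuclideanSpace ℝ (Fin 3) ≃ₗᵢ[ℝ] EuclideanSpace ℝ (Fin 3)) {y : EuclideanSpace ℝ (Fin 3)}
    (hy : y ∈ coreOf X z S) (hzy : dist z y ≤ 2) (L : EuclideanSpace ℝ (Fin 3) ≃ₗᵢ[ℝ] EuclideanSpace ℝ (Fin 3))
    (hocc : ∀ k ∈ lowerNine, y + L (slotSite k) ∈ coreOf X z S) :
    ((X \ coreOf X z S).filter fun x => dist y x = 1).card ≤ 2 := by
  set D := coreOf X z S with hD
  have hDX : D ⊆ X := coreOf_subset X z S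
  refine le_trans (card_le_card fun x hx => ?_) (card_offTip_contacts_le_two hX L (y := y) fun k hk => hDX (hocc k hk))
  obtain ⟨hxXD, hyx⟩ := mem_filter.1 hx
  obtain ⟨hxX, hxD⟩ := mem_sdiff.1 hxXD
  refine mem_filter.2 ⟨hxX, hyx, fun k hk h => hxD (h ▸ hocc k hk), fun ht => hxD ?_⟩
  -- a junk ball at a tip would cap a core triangle, hence be in the core
  have hxW : x ∈ X.filter fun x => dist z x ≤ 3 := mem_filter.2 ⟨hxX, by linarith [dist_triangle z y x]⟩
  have hcap : CapsTriangleIn D x := by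
    have := capsTriangleIn_of_tip L hy hocc ht
    rwa [LinearIsometryEquiv.apply_symm_apply, add_sub_cancel] at this
  exact mem_capClosure_of_capsTriangleIn (siteBallsAt_subset _ _ _) hxW hcap

open scoped Classical in
/-- **ROW «eleven slots ⇒ 0»**: a core ball `y` within `2` of the payer whose positions `y + L(slotSite k)`, `k ≠ 2`, are CORE balls is touched by no ball outside
the core (the only free position is the tip, which caps a core triangle). -/
theorem junk_contacts_eq_zero_of_eleven {X : Finset (EuclideanSpace ℝ (Fin 3))} (hX : ∀ p ∈ X, ∀ q ∈ X, p ≠ q → 1 ≤ dist p q)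
    {z : EuclideanSpace ℝ (Fin 3)} (S : EuclideanSpace ℝ (Fin 3) ≃ₗᵢ[ℝ] EuclideanSpace ℝ (Fin 3)) {y : EuclideanSpace ℝ (Fin 3)}
    (hy : y ∈ coreOf X z S) (hzy : dist z y ≤ 2) (L : EuclideanSpace ℝ (Fin 3) ≃ₗᵢ[ℝ] EuclideanSpace ℝ (Fin 3))
    (hocc : ∀ k : Fin 12, k ≠ 2 → y + L (slotSite k) ∈ coreOf X z S) :
    ((X \ coreOf X z S).filter fun x => dist y x = 1).card = 0 := by
  set D := coreOf X z S with hD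
  have hDX : D ⊆ X := coreOf_subset X z S
  rw [card_eq_zero, eq_empty_iff_forall_notMem]
  intro x hx
  obtain ⟨hxXD, hyx⟩ := mem_filter.1 hx
  obtain ⟨hxX, hxD⟩ := mem_sdiff.1 hxXD
  have hxt : x = y + L (slotSite 2) :=
    contact_eq_tip_of_eleven hX L (fun k hk => hDX (hocc k hk)) hxX hyx fun k hk h => hxD (h ▸ hocc k hk)
  have hxW : x ∈ X.filter fun x => dist z x ≤ 3 := mem_filter.2 ⟨hxX, by linarith [dist_triangle z y x]⟩
  have hocc9 : ∀ k ∈ lowerNine, y + L (slotSite k) ∈ D := fun k hk => hocc k (by intro h; subst h; simp [lowerNine] at hk)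
  have hcap : CapsTriangleIn D x := by
    rw [hxt]; exact capsTriangleIn_of_tip L hy hocc9 (by simp [healTips])
  exact hxD (mem_capClosure_of_capsTriangleIn (siteBallsAt_subset _ _ _) hxW hcap)

end TailResidue

end Summit.Ventures.Crystal3D.Theorems

end
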